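import Literature.NumberTheory.NumberFields.EquivariantIwasawaLemmaClassGroup
import Literature.NumberTheory.NumberFields.ArtinMapDecompositionInertia
import Literature.NumberTheory.GaloisRepresentations.ArtinRestriction
import HarnessLib

/-!
# Equivariant descent of an unramified character, III: an everywhere-unramified `Γ_K`-equivariant
# character of `Gal(K̄/L)` dies if the `Γ_K`-equivariant part of `Cl(L)` does (equivariant Artin
# reciprocity, absolute form) — PROVED

Topic `NumberTheory/NumberFields` (namespace = path, grouping sub-namespace
`EquivariantUnramifiedDescent`).  THEOREM-ONLY file (no definition, no named fact, no `sorry`),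
written by the literature seat `bsd-potss-conjA-anchor` g17 (cell `bsd-potss`; serves the asides
stmt-BirchSwinnertonDyer-19386 / 19413; closes nothing).  Sequel of
`EquivariantUnramifiedDescent{,Open}.lean`, which produce from a fine Selmer class an open subgroup
`Q ⊴ Γ_K` inside `Λ′ = Gal(K̄/L)` and a map `ψ : Γ_K → V`, additive and `Γ_K`-equivariant on `Λ′`,
with kernel `Q` on `Λ′`, killing every inertia group `I_𝔓 ∩ Λ′`.  Here that output is fed into
class field theory:

* **`forall_eq_zero_of_forall_equivariantHom_classGroup_eq_zero`** — `K` a number field, `p` an odd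
  prime, `L ⊆ K̄` finite Galois over `K`, `Λ′ = {σ : σ|_L = 1}`, `Q ⊴ Γ_K` open with `Q ≤ Λ′`, `V` a
  `p`-torsion `Γ_K`-module, `ψ : Γ_K → V` additive and `Γ_K`-equivariant on `Λ′` with
  `ker ψ ∩ Λ′ = Q` and `ψ(I_𝔓 ∩ Λ′) = 0` for every maximal ideal `𝔓` of `ℤ̄_K`.  If every additive
  `Γ_K`-equivariant `μ : Cl(𝓞_L) → V` is zero (equivariance through
  `τ ↦ ClassGroup.mulEquiv (intAut τ|_L)`, the currency of the tree's door-L6 theorem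
  `DeoRaySujatha2023.homTrivial_divisionField_cyclotomicTower`), then `ψ = 0` on `Λ′`.
  PROOF.  `E′ = K̄^Q` is finite Galois over `K` and contains `L`; `ψ` descends to an injective-modulo-`Q`
  additive `ψ̄ : G = Gal(E′/L) → V`, so `G` has exponent `p`, odd order, and `E′/L` is unramified at
  infinity (Mathlib `IsUnramifiedAtInfinitePlaces_of_odd_card_aut`); the inertia group in `G` of a
  maximal ideal of `𝓞_{E′}` is the restriction of an absolute inertia group (tree
  `inertia_comap_ringOfIntegers_eq_map_absRestrictNormalHom`, Serre I §7 Prop. 22 b), so `ψ̄` kills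
  it.  Composing with restriction `Gal(H_{E′}/L) → Gal(E′/L)` (`H_{E′}` the Hilbert class field) gives
  an additive, inertia-trivial, `Γ_K`-equivariant `χ`, which vanishes by the tree's equivariant Artin
  reciprocity `EquivariantIwasawaLemma.inertiaTrivialHom_eq_zero_of_classGroupHom_eq_zero` (Cox Thm.
  8.10 / Neukirch VI (6.9), IV §6) once the class-group hypothesis is transported from `L` to its copy
  `IntermediateField.restrict (L ≤ E′)` (as in `EquivariantIwasawaLemmaAbsolute.lean`).  Every element
  of `G` lifts to `Gal(H_{E′}/L)`, so `ψ̄ = 0` and `ψ|_{Λ′} = 0`.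

This is the class-field-theoretic step («an everywhere unramified `p`-elementary extension of `L_n`
on whose Galois group `G` acts through `E[p]` is seen by `Hom_G(Cl(L_n), E[p])`») of the cell's
H²-free proof of «door L6 ⟹ Conjecture A» (Coates–Sujatha 2005 Thm. 3.4, isotypic form); nothing
about elliptic curves is used here.

## References

* D. A. Cox, *Primes of the form x² + ny²*, 2nd ed. (2013), §8.A Thm. 8.10, §5.C Cor. 5.24. [Cox2013]
* J. Neukirch, *Algebraic Number Theory* (1999), Ch. VI (6.9), (7.1); Ch. IV §6; Ch. I §9. [NeukirchANT1999]
* J.-P. Serre, *Local Fields*, GTM 67 (1979), Ch. I §7 Prop. 22 (b). [SerreLocalFields1979]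
* J. Coates, R. Sujatha, *Fine Selmer groups of elliptic curves over p-adic Lie extensions*,
  Math. Ann. 331 (2005), §3 Thm. 3.4 (proof). [CoatesSujatha2005]
-/

noncomputable section

open scoped Pointwise nonZeroDivisors
open NumberField Field IntermediateField Ideal IsDedekindDomain
open Literature.NumberTheory.GaloisRepresentations

namespace Literature.NumberTheory.NumberFields

namespace EquivariantUnramifiedDescent

section Helpers

variable {k : Type} [Field k]

/-- Restriction `Γ_k → Gal(E/k)` is onto. [folklore] -/
private theorem absRestrictNormalHom_surjective' (E : IntermediateField k (AlgebraicClosure k))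
    [Normal k E] : Function.Surjective (absRestrictNormalHom E) := fun g => by
  obtain ⟨σ, hσ⟩ := AlgEquiv.restrictNormalHom_surjective (AlgebraicClosure k) g
  exact ⟨(Field.absoluteGaloisGroup.toAlgEquiv k).symm σ, hσ⟩

/-- `((τ|_E) x : k̄) = τ • x`. [folklore] -/
private theorem coe_absRestrictNormalHom_apply' (E : IntermediateField k (AlgebraicClosure k))
    [Normal k E] (τ : absoluteGaloisGroup k) (x : E) :
    ((absRestrictNormalHom E τ x : E) : AlgebraicClosure k) = τ • (x : AlgebraicClosure k) :=
  AlgEquiv.restrictNormalHom_apply E _ x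

/-- `τ|_E = 1` iff `τ` fixes `E ⊆ k̄` pointwise. [folklore] -/
private theorem absRestrictNormalHom_eq_one_iff' (E : IntermediateField k (AlgebraicClosure k))
    [Normal k E] (τ : absoluteGaloisGroup k) :
    absRestrictNormalHom E τ = 1 ↔ ∀ x : E, τ • (x : AlgebraicClosure k) = x := by
  constructor
  · intro h x
    rw [← coe_absRestrictNormalHom_apply' E τ x, h, AlgEquiv.one_apply]
  · intro h
    ext x
    rw [coe_absRestrictNormalHom_apply' E τ x, AlgEquiv.one_apply]
    exact h x

/-- A ring isomorphism maps non-zero ideals to non-zero ideals. [folklore] -/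
private theorem map_mem_nonZeroDivisors' {R S : Type*} [CommRing R] [IsDomain R] [CommRing S]
    [IsDomain S] (g : R ≃+* S) (J : (Ideal R)⁰) : (J : Ideal R).map (g : R →+* S) ∈ (Ideal S)⁰ := by
  rw [mem_nonZeroDivisors_iff_ne_zero]
  intro h
  exact nonZeroDivisors.ne_zero J.2 ((Ideal.map_eq_bot_iff_of_injective g.injective).mp h)

/-- `ClassGroup.mulEquiv g` on the class of an integral ideal `J` is the class of `g(J)`. [folklore] -/
private theorem mulEquiv_mk0' {R S : Type*} [CommRing R] [IsDedekindDomain R] [CommRing S]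
    [IsDedekindDomain S] (g : R ≃+* S) (J : (Ideal R)⁰) :
    ClassGroup.mulEquiv g (ClassGroup.mk0 J) =
      ClassGroup.mk0 ⟨_, map_mem_nonZeroDivisors' g J⟩ := by
  have hmk : ∀ I : (FractionalIdeal R⁰ (FractionRing R))ˣ,
      ClassGroup.mulEquiv g (ClassGroup.mk (FractionRing R) I) =
        ClassGroup.mk (FractionRing S) (Units.mapEquiv
          (FractionalIdeal.ringEquivOfRingEquiv (FractionRing R) (FractionRing S) g).toMulEquiv I) :=
    fun I => by
    rw [ClassGroup.mulEquiv, MulEquiv.trans_apply, MulEquiv.trans_apply, ClassGroup.equiv_mk,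
      MulEquiv.symm_apply_eq, ClassGroup.equiv_mk, QuotientGroup.congr_mk']
    congr 1
    ext1
    simp [FractionalIdeal.canonicalEquiv_self]
  rw [← ClassGroup.mk_mk0 (FractionRing R) J, hmk, ← ClassGroup.mk_mk0 (FractionRing S)]
  congr 1
  ext1
  rw [Units.coe_mapEquiv, FractionalIdeal.coe_mk0, FractionalIdeal.coe_mk0]
  exact AmbiguousClass.ringEquivOfRingEquiv_coeIdeal _ _ g J

/-- A prime of `ℤ̄_k` above a given maximal ideal of `𝓞 E`, for a number field `E ⊆ k̄`; it is maximal.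
[folklore] -/
private theorem exists_isMaximal_comap_eq (E : IntermediateField k (AlgebraicClosure k))
    (Q : Ideal (𝓞 E)) [hQ : Q.IsMaximal] :
    ∃ 𝔓 : Ideal (absIntegers (𝓞 k) k), 𝔓.IsMaximal ∧
      𝔓.comap (EllipticCurves.ringOfIntegersToIntegralClosure (k := k)
        (Ω := AlgebraicClosure k) E) = Q := by
  set φ : 𝓞 E →+* absIntegers (𝓞 k) k :=
    EllipticCurves.ringOfIntegersToIntegralClosure (k := k) (Ω := AlgebraicClosure k) E with hφ
  letI : Algebra (𝓞 E) (absIntegers (𝓞 k) k) := φ.toAlgebra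
  haveI : IsScalarTower (𝓞 k) (𝓞 E) (absIntegers (𝓞 k) k) :=
    IsScalarTower.of_algebraMap_eq fun x ↦ rfl
  haveI : Algebra.IsIntegral (𝓞 E) (absIntegers (𝓞 k) k) :=
    ⟨fun x ↦ (Algebra.IsIntegral.isIntegral (R := 𝓞 k) x).tower_top⟩
  obtain ⟨𝔓, -, h𝔓prime, h𝔓Q⟩ := Ideal.exists_ideal_over_prime_of_isIntegral Q
    (⊥ : Ideal (absIntegers (𝓞 k) k))
    (fun x hx ↦ by
      rw [Ideal.mem_comap, Ideal.mem_bot] at hx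
      have hx0 : x = 0 :=
        EllipticCurves.ringOfIntegersToIntegralClosure_injective E (hx.trans (map_zero _).symm)
      rw [hx0]
      exact Q.zero_mem)
  haveI := h𝔓prime
  refine ⟨𝔓, Ideal.isMaximal_of_isIntegral_of_isMaximal_comap (R := 𝓞 E) 𝔓 ?_, h𝔓Q⟩
  rw [h𝔓Q]
  exact hQ

end Helpers

section Main

variable {K : Type} [Field K] [NumberField K]

set_option maxHeartbeats 1600000 in
set_option synthInstance.maxHeartbeats 200000 in
/-- **An everywhere-unramified equivariant character of `Gal(K̄/L)` vanishes if `Hom_{Γ_K}(Cl(L), V) = 0`.**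
`K` a number field, `p` an odd prime, `L ⊆ K̄` finite Galois over `K`, `Λ′ = {σ ∈ Γ_K : σ|_L = 1}`,
`Q ⊴ Γ_K` open with `Q ≤ Λ′`; `V` a `p`-torsion `Γ_K`-module; `ψ : Γ_K → V` additive on `Λ′`,
`Γ_K`-equivariant on `Λ′` (`ψ(gσg⁻¹) = g • ψ(σ)`), with `ψ(σ) = 0 ↔ σ ∈ Q` on `Λ′`, and killing
`I_𝔓 ∩ Λ′` for every maximal ideal `𝔓` of `ℤ̄_K`.  If every additive `Γ_K`-equivariant
`μ : Cl(𝓞_L) → V` is zero, then `ψ(σ) = 0` for all `σ ∈ Λ′`.  See the module docstring for the proof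
(descent to `Gal(K̄^Q/L)`, odd order, inertia = restricted inertia, Hilbert class field and the
equivariant Artin isomorphism).
[cite: Cox2013, §8.A Thm. 8.10 and §5.C Cor. 5.24]
[cite: NeukirchANT1999, Ch. VI (6.9), (7.1) and Ch. IV §6 (equivariance of the Artin symbol)]
[cite: SerreLocalFields1979, Ch. I §7 Prop. 22(b)] -/
theorem forall_eq_zero_of_forall_equivariantHom_classGroup_eq_zero (p : ℕ) [Fact p.Prime]
    (hp2 : p ≠ 2) (L : IntermediateField K (AlgebraicClosure K)) [FiniteDimensional K L]
    [IsGalois K L] (Λ' Q : Subgroup (absoluteGaloisGroup K))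
    (hΛ' : ∀ σ, σ ∈ Λ' ↔ absRestrictNormalHom L σ = 1) [hQn : Q.Normal]
    (hQ : IsOpen (Q : Set (absoluteGaloisGroup K))) (hQΛ' : Q ≤ Λ')
    {V : Type*} [AddCommGroup V] [DistribMulAction (absoluteGaloisGroup K) V]
    (hpV : ∀ v : V, p • v = 0) (ψ : absoluteGaloisGroup K → V)
    (hψmul : ∀ a ∈ Λ', ∀ b ∈ Λ', ψ (a * b) = ψ a + ψ b)
    (hψequiv : ∀ (g : absoluteGaloisGroup K), ∀ σ ∈ Λ', ψ (g * σ * g⁻¹) = g • ψ σ)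
    (hψker : ∀ σ ∈ Λ', ψ σ = 0 ↔ σ ∈ Q)
    (hψI : ∀ (𝔓 : Ideal (absIntegers (𝓞 K) K)), 𝔓.IsMaximal →
      ∀ σ ∈ 𝔓.inertia (absoluteGaloisGroup K), σ ∈ Λ' → ψ σ = 0)
    (h0 : ∀ μ : Additive (ClassGroup (𝓞 L)) →+ V,
      (∀ (τ : absoluteGaloisGroup K) (c : ClassGroup (𝓞 L)),
        μ (Additive.ofMul (ClassGroup.mulEquiv
          (AmbiguousClass.intAut (absRestrictNormalHom L τ)) c)) = τ • μ (Additive.ofMul c)) →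
      μ = 0) :
    ∀ σ ∈ Λ', ψ σ = 0 := by
  classical
  have hp : p.Prime := Fact.out
  haveI : Algebra.IsAlgebraic K (AlgebraicClosure K) := AlgebraicClosure.isAlgebraic K
  haveI : IsGalois K (AlgebraicClosure K) := {}
  haveI : NumberField L := NumberField.of_module_finite K L
  -- ### elementary consequences of additivity
  have hψ1 : ψ 1 = 0 := by
    have h := hψmul 1 Λ'.one_mem 1 Λ'.one_mem
    rw [mul_one] at h
    exact left_eq_add.mp h
  have hψpow : ∀ u ∈ Λ', ∀ n : ℕ, ψ (u ^ n) = n • ψ u := by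
    intro u hu n
    induction n with
    | zero => rw [pow_zero, hψ1, zero_smul]
    | succ n ih => rw [pow_succ, hψmul _ (Λ'.pow_mem hu n) _ hu, ih, succ_nsmul]
  -- ### the field `E' = K̄^Q ⊇ L`
  set E' : IntermediateField K (AlgebraicClosure K) := fixedField Q with hE'def
  have hE'Q : E'.fixingSubgroup = Q := fixingSubgroup_fixedField_of_isOpen Q hQ
  haveI : FiniteDimensional K E' := finiteDimensional_fixedField_of_isOpen Q hQ
  haveI hE'gal : IsGalois K E' := by
    rw [← InfiniteGalois.normal_iff_isGalois, hE'Q]; exact hQn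
  haveI : NumberField E' := NumberField.of_module_finite K E'
  have hΛ'fix : ∀ σ, σ ∈ Λ' ↔ ∀ x : L, σ • (x : AlgebraicClosure K) = x := fun σ =>
    (hΛ' σ).trans (absRestrictNormalHom_eq_one_iff' L σ)
  have hLE' : L ≤ E' := by
    rw [hE'def, IntermediateField.le_iff_le]
    intro σ hσ
    rw [IntermediateField.mem_fixingSubgroup_iff]
    intro x hx
    exact (hΛ'fix σ).1 (hQΛ' hσ) ⟨x, hx⟩
  -- ### `L` as an intermediate field `Li` of `E'/K`
  set Li : IntermediateField K E' := IntermediateField.restrict hLE' with hLidef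
  set eL : L ≃ₐ[K] Li := IntermediateField.restrict_algEquiv hLE' with heLdef
  have heL : ∀ y : L, (((eL y : Li) : E') : AlgebraicClosure K) = (y : AlgebraicClosure K) :=
    fun _ => rfl
  have hmemL : ∀ x : Li, ((x : E') : AlgebraicClosure K) ∈ L := fun x => (mem_restrict hLE' x.1).1 x.2
  haveI : IsGalois K Li := IsGalois.of_algEquiv eL
  haveI : FiniteDimensional K Li := IntermediateField.finiteDimensional_left Li
  haveI : NumberField Li := NumberField.of_module_finite K Li
  haveI : IsGalois Li E' := IsGalois.tower_top_of_isGalois K Li E'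
  haveI : FiniteDimensional Li E' := Module.Finite.of_restrictScalars_finite K Li E'
  -- ### the restriction `π : Γ_K → Gal(E'/K)`
  set π : absoluteGaloisGroup K →* (E' ≃ₐ[K] E') := absRestrictNormalHom E' with hπdef
  have hπ : Function.Surjective π := absRestrictNormalHom_surjective' E'
  have hval : ∀ (τ : absoluteGaloisGroup K) (x : E'),
      ((π τ x : E') : AlgebraicClosure K) = τ • (x : AlgebraicClosure K) :=
    coe_absRestrictNormalHom_apply' E'
  have hQiff : ∀ σ : absoluteGaloisGroup K, σ ∈ Q ↔ ∀ x ∈ E', σ • x = x := fun σ => by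
    refine (SetLike.ext_iff.mp hE'Q σ).symm.trans ?_
    exact IntermediateField.mem_fixingSubgroup_iff E' (absoluteGaloisGroup.toAlgEquiv K σ)
  have hπ1 : ∀ τ, π τ = 1 ↔ τ ∈ Q := by
    intro τ
    rw [hπdef, absRestrictNormalHom_eq_one_iff' E', hQiff]
    exact ⟨fun h x hx => h ⟨x, hx⟩, fun h x => h x x.2⟩
  -- `σ ∈ Λ' ↔ π σ fixes Li pointwise`
  have hL1 : ∀ τ : absoluteGaloisGroup K,
      absRestrictNormalHom L τ = 1 ↔ ∀ x : Li, π τ (x : E') = x := by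
    intro τ
    rw [absRestrictNormalHom_eq_one_iff']
    constructor
    · intro h x
      apply Subtype.ext
      rw [hval]
      exact h ⟨_, hmemL x⟩
    · intro h y
      have := congrArg (fun z : E' => (z : AlgebraicClosure K)) (h (eL y))
      rwa [hval] at this
  have hΛ'1 : ∀ τ, τ ∈ Λ' ↔ ∀ x : Li, π τ (x : E') = x := fun τ => (hΛ' τ).trans (hL1 τ)
  -- ### the relative restriction `πL : Λ' → Gal(E'/Li)`
  have hres_mem : ∀ u : Λ', π (u : absoluteGaloisGroup K) ∈ Li.fixingSubgroup := by
    intro u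
    rw [IntermediateField.mem_fixingSubgroup_iff]
    intro x hx
    exact (hΛ'1 u).1 u.2 ⟨x, hx⟩
  let πL : Λ' →* (E' ≃ₐ[Li] E') :=
    (IntermediateField.fixingSubgroupEquiv Li).toMonoidHom.comp
      ((π.comp Λ'.subtype).codRestrict Li.fixingSubgroup hres_mem)
  have hπL : ∀ u : Λ', (πL u).restrictScalars K = π (u : absoluteGaloisGroup K) := fun u => rfl
  have hmemΛ'_of : ∀ (σ : absoluteGaloisGroup K) (τ : E' ≃ₐ[Li] E'),
      π σ = τ.restrictScalars K → σ ∈ Λ' := by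
    intro σ τ hσ
    rw [hΛ'1]
    intro x
    rw [hσ, AlgEquiv.restrictScalars_apply]
    exact τ.commutes x
  have hπL_surj : Function.Surjective πL := by
    intro τ
    obtain ⟨σ, hσ⟩ := hπ (τ.restrictScalars K)
    refine ⟨⟨σ, hmemΛ'_of σ τ hσ⟩, ?_⟩
    apply AlgEquiv.restrictScalars_injective K
    rw [hπL]
    exact hσ
  have hπL_one : ∀ u : Λ', πL u = 1 ↔ (u : absoluteGaloisGroup K) ∈ Q := by
    intro u
    rw [← hπ1, ← hπL]
    constructor
    · intro h; rw [h]; rfl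
    · intro h
      apply AlgEquiv.restrictScalars_injective K
      rw [h]; rfl
  have hπL_conj : ∀ (g : absoluteGaloisGroup K) (u : Λ'),
      (g * u * g⁻¹ : absoluteGaloisGroup K) ∈ Λ' := fun g u => by
    have hu := (hΛ' u).1 u.2
    rw [hΛ', map_mul, map_mul, map_inv, hu, mul_one, mul_inv_cancel]
  -- ### descent of `ψ` to `ψ̄ : Gal(E'/Li) → V`
  have hfactor : ∀ u₁ u₂ : Λ', πL u₁ = πL u₂ → ψ u₁ = ψ u₂ := by
    intro u₁ u₂ h
    have h1 : πL (u₂⁻¹ * u₁) = 1 := by rw [map_mul, map_inv, h, inv_mul_cancel]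
    have h2 : ψ ((u₂⁻¹ * u₁ : Λ') : absoluteGaloisGroup K) = 0 :=
      (hψker _ (u₂⁻¹ * u₁).2).2 ((hπL_one _).1 h1)
    have h3 : ψ u₁ = ψ ((u₂ : absoluteGaloisGroup K) * (u₂⁻¹ * u₁ : Λ')) := by
      rw [Subgroup.coe_mul, Subgroup.coe_inv, mul_inv_cancel_left]
    rw [h3, hψmul _ u₂.2 _ (u₂⁻¹ * u₁).2, h2, add_zero]
  let ψbar : (E' ≃ₐ[Li] E') → V := fun τ =>
    ψ ((Function.surjInv hπL_surj τ : Λ') : absoluteGaloisGroup K)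
  have hψbar : ∀ u : Λ', ψbar (πL u) = ψ u := fun u =>
    hfactor _ _ (Function.surjInv_eq hπL_surj (πL u))
  have hψbar_add : ∀ a b, ψbar (a * b) = ψbar a + ψbar b := by
    intro a b
    obtain ⟨x, rfl⟩ := hπL_surj a
    obtain ⟨y, rfl⟩ := hπL_surj b
    rw [← map_mul, hψbar, hψbar, hψbar, Subgroup.coe_mul, hψmul _ x.2 _ y.2]
  -- `Gal(E'/Li)` has exponent `p`, hence odd order: `E'/Li` unramified at infinity
  have hexp : ∀ τ : E' ≃ₐ[Li] E', τ ^ p = 1 := by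
    intro τ
    obtain ⟨u, rfl⟩ := hπL_surj τ
    rw [← map_pow, hπL_one, Subgroup.coe_pow]
    exact (hψker _ (Λ'.pow_mem u.2 p)).1 (by rw [hψpow _ u.2, hpV])
  haveI : IsUnramifiedAtInfinitePlaces Li E' := by
    apply IsUnramifiedAtInfinitePlaces_of_odd_card_aut
    have hG : IsPGroup p (E' ≃ₐ[Li] E') := fun τ => ⟨1, by rw [pow_one]; exact hexp τ⟩
    obtain ⟨m, hm⟩ := hG.exists_card_eq
    rw [hm]
    exact (hp.odd_of_ne_two hp2).pow
  -- ### `ψ̄` kills the inertia groups of `Gal(E'/Li)`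
  have hinert : ∀ (𝔔 : Ideal (𝓞 E')) [𝔔.IsMaximal],
      ∀ τ ∈ 𝔔.inertia (E' ≃ₐ[Li] E'), ψbar τ = 0 := by
    intro 𝔔 _ τ hτ
    obtain ⟨𝔓, h𝔓max, h𝔓Q⟩ := exists_isMaximal_comap_eq E' 𝔔
    haveI := h𝔓max
    have hτK : τ.restrictScalars K ∈ 𝔔.inertia (E' ≃ₐ[K] E') := by
      rw [AddSubgroup.mem_inertia] at hτ ⊢
      intro x
      rw [RingOfIntegers.restrictScalars_smul]
      exact hτ x
    rw [← h𝔓Q, inertia_comap_ringOfIntegers_eq_map_absRestrictNormalHom E' 𝔓] at hτK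
    obtain ⟨σ, hσI, hσ⟩ := hτK
    have hσΛ : σ ∈ Λ' := hmemΛ'_of σ τ hσ
    have hπσ : πL ⟨σ, hσΛ⟩ = τ := by
      apply AlgEquiv.restrictScalars_injective K
      rw [hπL]
      exact hσ
    rw [← hπσ, hψbar]
    exact hψI 𝔓 h𝔓max σ hσI hσΛ
  -- ### (c2*) for `Li`, transported from `L` along `eL`
  have h0Li : ∀ μ : Additive (ClassGroup (𝓞 Li)) →+ V,
      (∀ (τ : absoluteGaloisGroup K) (c : ClassGroup (𝓞 Li)),
        μ (Additive.ofMul (ClassGroup.mulEquiv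
          (AmbiguousClass.intAut ((π τ).restrictNormal Li)) c)) = τ • μ (Additive.ofMul c)) →
      μ = 0 := by
    intro μ hμ
    set gL : 𝓞 L ≃+* 𝓞 Li := RingOfIntegers.mapRingEquiv eL.toRingEquiv with hgLdef
    set eCl : ClassGroup (𝓞 L) ≃* ClassGroup (𝓞 Li) := ClassGroup.mulEquiv gL with heCldef
    set μ' : Additive (ClassGroup (𝓞 L)) →+ V :=
      AddMonoidHom.mk' (fun a => μ (Additive.ofMul (eCl (Additive.toMul a))))
        (fun a b => by simp only [toMul_add, map_mul, ofMul_mul, map_add]) with hμ'def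
    have hμ'apply : ∀ c : ClassGroup (𝓞 L),
        μ' (Additive.ofMul c) = μ (Additive.ofMul (eCl c)) := fun _ => rfl
    have hgcomp : ∀ τ : absoluteGaloisGroup K,
        (gL : 𝓞 L →+* 𝓞 Li).comp (AmbiguousClass.intAut (absRestrictNormalHom L τ) : 𝓞 L →+* 𝓞 L) =
          (AmbiguousClass.intAut ((π τ).restrictNormal Li) : 𝓞 Li →+* 𝓞 Li).comp
            (gL : 𝓞 L →+* 𝓞 Li) := by
      intro τ
      refine RingHom.ext fun y => Subtype.ext <| Subtype.ext <| Subtype.ext ?_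
      change (((eL (absRestrictNormalHom L τ (y : L)) : Li) : E') : AlgebraicClosure K) =
        ((algebraMap Li E' (((π τ).restrictNormal Li) (eL (y : L))) : E') : AlgebraicClosure K)
      rw [AlgEquiv.restrictNormal_commutes, heL, coe_absRestrictNormalHom_apply' L, hval]
      rfl
    have hcomp : ∀ (τ : absoluteGaloisGroup K) (c : ClassGroup (𝓞 L)),
        eCl (ClassGroup.mulEquiv (AmbiguousClass.intAut (absRestrictNormalHom L τ)) c) =
          ClassGroup.mulEquiv (AmbiguousClass.intAut ((π τ).restrictNormal Li)) (eCl c) := by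
      intro τ c
      obtain ⟨J, rfl⟩ := ClassGroup.mk0_surjective c
      rw [AmbiguousClass.mulEquiv_mk0, heCldef, mulEquiv_mk0', mulEquiv_mk0',
        AmbiguousClass.mulEquiv_mk0]
      congr 1
      apply Subtype.ext
      change ((J : Ideal (𝓞 L)).map _).map _ = ((J : Ideal (𝓞 L)).map _).map _
      rw [Ideal.map_map, Ideal.map_map, hgcomp]
    have hμ' : μ' = 0 := by
      refine h0 μ' fun τ c => ?_
      rw [hμ'apply, hμ'apply, hcomp]
      exact hμ τ (eCl c)
    refine AddMonoidHom.ext fun a => ?_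
    obtain ⟨c, rfl⟩ : ∃ c : ClassGroup (𝓞 Li), Additive.ofMul c = a := ⟨Additive.toMul a, rfl⟩
    have h := congrArg (fun ν : Additive (ClassGroup (𝓞 L)) →+ V => ν (Additive.ofMul (eCl.symm c))) hμ'
    simpa only [hμ'apply, MulEquiv.apply_symm_apply, AddMonoidHom.zero_apply] using h
  -- ### the Hilbert class field `H = H_{E'}` and `χ = ψ̄ ∘ res`
  haveI : IsScalarTower K E' (hilbertClassField E') :=
    IsScalarTower.of_algebraMap_eq fun x => Subtype.ext (IsScalarTower.algebraMap_apply K E' _ x)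
  haveI : IsScalarTower Li E' (hilbertClassField E') :=
    IsScalarTower.of_algebraMap_eq fun x => Subtype.ext (IsScalarTower.algebraMap_apply Li E' _ x)
  haveI : IsScalarTower K Li (hilbertClassField E') := IsScalarTower.of_algebraMap_eq fun x => by
    rw [IsScalarTower.algebraMap_apply Li E' (hilbertClassField E'),
      ← IsScalarTower.algebraMap_apply K Li E', ← IsScalarTower.algebraMap_apply K E' (hilbertClassField E')]
  haveI : IsGalois Li (hilbertClassField E') := hilbertClassField.isGalois_of_isGalois E' (K := Li)
  set rE : (hilbertClassField E' ≃ₐ[Li] hilbertClassField E') →* (E' ≃ₐ[Li] E') :=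
    AlgEquiv.restrictNormalHom E' with hrEdef
  have hrE_apply : ∀ a (x : E'), algebraMap E' (hilbertClassField E') (rE a x) =
      a (algebraMap E' (hilbertClassField E') x) := fun a x => AlgEquiv.restrictNormal_commutes a E' x
  have hrE_surj : Function.Surjective rE :=
    AlgEquiv.restrictNormalHom_surjective (hilbertClassField E')
  let χ : (hilbertClassField E' ≃ₐ[Li] hilbertClassField E') → V := fun a => ψbar (rE a)
  have hχadd : ∀ a b, χ (a * b) = χ a + χ b := by
    intro a b
    change ψbar (rE (a * b)) = ψbar (rE a) + ψbar (rE b)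
    rw [map_mul, hψbar_add]
  -- `χ` kills the inertia groups of `Gal(H/Li)` (they restrict into inertia groups of `Gal(E'/Li)`)
  have hχI : ∀ (Q' : Ideal (𝓞 (hilbertClassField E'))) [Q'.IsMaximal],
      ∀ s ∈ Q'.inertia (hilbertClassField E' ≃ₐ[Li] hilbertClassField E'), χ s = 0 := by
    intro Q' _ s hs
    haveI : (Q'.under (𝓞 E')).IsMaximal := Ideal.IsMaximal.under (𝓞 E') Q'
    refine hinert (Q'.under (𝓞 E')) (rE s) ?_
    rw [AddSubgroup.mem_inertia] at hs ⊢
    intro y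
    change algebraMap (𝓞 E') (𝓞 (hilbertClassField E')) (rE s • y - y) ∈ Q'
    have hsm : algebraMap (𝓞 E') (𝓞 (hilbertClassField E')) (rE s • y) =
        s • algebraMap (𝓞 E') (𝓞 (hilbertClassField E')) y := by
      apply RingOfIntegers.coe_injective
      change algebraMap E' (hilbertClassField E') ((rE s) (y : E')) =
        s (algebraMap E' (hilbertClassField E') (y : E'))
      exact hrE_apply s (y : E')
    rw [map_sub, hsm]
    exact hs _
  -- `χ` is `Γ_K`-equivariant
  have hχequiv : ∀ (τ : absoluteGaloisGroup K)
      (g : hilbertClassField E' ≃ₐ[K] hilbertClassField E')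
      (a a' : hilbertClassField E' ≃ₐ[Li] hilbertClassField E'),
      AlgEquiv.restrictNormalHom E' g = π τ → (∀ y, a' y = g (a (g.symm y))) → χ a' = τ • χ a := by
    intro τ g a a' hg ha'
    obtain ⟨u, hu⟩ := hπL_surj (rE a)
    -- `g` restricts to `π τ` on `E'`
    have hg_apply : ∀ x : E', g (algebraMap E' (hilbertClassField E') x) =
        algebraMap E' (hilbertClassField E') (π τ x) := by
      intro x
      rw [← hg]
      exact (AlgEquiv.restrictNormal_commutes g E' x).symm
    have hg_symm : ∀ x : E', g.symm (algebraMap E' (hilbertClassField E') x) =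
        algebraMap E' (hilbertClassField E') ((π τ)⁻¹ x) := by
      intro x
      apply g.injective
      rw [AlgEquiv.apply_symm_apply, hg_apply, ← AlgEquiv.mul_apply, mul_inv_cancel,
        AlgEquiv.one_apply]
    -- `a'` restricts to `πL (τ u τ⁻¹)` on `E'`
    have hconj : rE a' = πL ⟨τ * u * τ⁻¹, hπL_conj τ u⟩ := by
      apply AlgEquiv.ext
      intro x
      have h1 : algebraMap E' (hilbertClassField E') (rE a' x) =
          algebraMap E' (hilbertClassField E') (π τ (rE a ((π τ)⁻¹ x))) := by
        rw [hrE_apply, ha', hg_symm, ← hrE_apply, hg_apply]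
      have h2 : rE a' x = π τ (rE a ((π τ)⁻¹ x)) :=
        (algebraMap E' (hilbertClassField E')).injective h1
      rw [h2, ← hu]
      apply Subtype.ext
      change ((π τ ((πL u).restrictScalars K ((π τ)⁻¹ x)) : E') : AlgebraicClosure K) =
        (((πL ⟨τ * u * τ⁻¹, hπL_conj τ u⟩).restrictScalars K x : E') : AlgebraicClosure K)
      rw [hπL, hπL, ← map_inv, hval, hval, hval, hval]
      change τ • ((u : absoluteGaloisGroup K) • (τ⁻¹ • (x : AlgebraicClosure K))) =
        (τ * u * τ⁻¹) • (x : AlgebraicClosure K)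
      rw [mul_smul, mul_smul]
    change ψbar (rE a') = τ • ψbar (rE a)
    rw [hconj, hψbar, ← hu, hψbar]
    exact hψequiv τ u u.2
  -- ### equivariant Artin reciprocity: `χ = 0`
  have key : ∀ a, χ a = 0 := fun a =>
    EquivariantIwasawaLemma.inertiaTrivialHom_eq_zero_of_classGroupHom_eq_zero (k := K) (B := Li)
      (F := E') π hπ h0Li χ hχadd (fun Q' _ s hs => hχI Q' s hs) hχequiv a
  -- ### conclusion
  intro σ hσ
  obtain ⟨a, ha⟩ := hrE_surj (πL ⟨σ, hσ⟩)
  have h := key a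
  change ψbar (rE a) = 0 at h
  rw [ha, hψbar] at h
  exact h

end Main

end EquivariantUnramifiedDescent

end Literature.NumberTheory.NumberFields

end
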